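import Mathlib
import Summits.QuantumFields.YangMills.Theorems.UniversalDetectorLatticeRiemannLimit

/-!
# Route `UniversalDetector`, support item `LimitExtraction` (stmt-QuantumFields-26597): the `Q2`-shaped continuum limit

Ideator seat ym-idea-8 g4.  Specialisation of `tendsto_latticeRiemannSum₂`
(`UniversalDetectorLatticeRiemannLimit`) to the integrand of NT's `Q2`:
`tendsto_latticeDoubleSum_schwartzKernel` — for real Schwartz `w₁, w₂` with `tsupport`s in the opposite time
slabs `{-y_{i₀} ≥ t₀}`, `{y_{i₀} ≥ t₀}` (`t₀ > 0`; the route's hypotheses with `i₀ = 0`, upper slab bounds not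
needed) and a kernel `K` continuous on `{z ≠ 0}` and bounded on `{‖z‖ ≥ η}` for every `η > 0` (the two
regularity conjuncts of `LimitExtraction`),
`s_k^{2d} Σ_{x,x' ∈ box d L_k} w₁(s_k x) w₂(s_k x') K(s_k x' - s_k x) → ∫ x, ∫ y, w₁ x * w₂ y * K (y - x)`
as `0 < s_k → 0`, `s_k L_k → ∞` — literally the limit expression of the route's last conjunct.  The separated
supports keep `y - x` at distance `≥ 2t₀` from the singularity of `K`, which gives continuity of the integrand on
`ℝ^d × ℝ^d` and product Schwartz decay; Fubini (`integral_prod`) turns the product integral into the iterated one.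
Combined with `UniversalDetectorLatticeRiemannPerturbation` (replace `a_k^{-8} Cov_k` by `K(a_k x' - a_k x)`),
the `Q2` conjunct is reduced to its lattice-gauge inputs: torus translation covariance of the plaquette two-point
function, the (TIGHT) bound at physical separation `≥ 2t₀`, and the local uniform convergence to `K`.
No summit, leg or spine statement is proved here.
-/

set_option autoImplicit false

namespace Summit.QuantumFields.YangMills.Cruxes.UniversalDetectorLimitExtraction

open Finset MeasureTheory Filter Topology Literature.Probability.LatticeModels
  Literature.MathematicalPhysics.QuantumLattice

/-- Polynomial decay of a Schwartz function: `|w u| ≤ C (1 + ‖u‖)^{-p}` with `C ≥ 0`. -/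
private lemma schwartz_decay' {d : ℕ} (w : SchwartzMap (EuclideanSpace ℝ (Fin d)) ℝ) (p : ℕ) :
    ∃ C : ℝ, 0 ≤ C ∧ ∀ u : EuclideanSpace ℝ (Fin d), |w u| ≤ C * ((1 + ‖u‖) ^ p)⁻¹ := by
  refine ⟨2 ^ p * (Finset.Iic (p, 0)).sup (fun m => SchwartzMap.seminorm ℝ m.1 m.2) w, by positivity,
    fun u => ?_⟩
  have h := SchwartzMap.one_add_le_sup_seminorm_apply (𝕜 := ℝ) (m := (p, 0)) le_rfl le_rfl w u
  rw [norm_iteratedFDeriv_zero, Real.norm_eq_abs] at h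
  rw [← div_eq_mul_inv, le_div_iff₀ (by positivity), mul_comm]
  exact h

/-- A coordinate is bounded by the Euclidean norm. -/
private lemma abs_apply_le_norm'' {d : ℕ} (u : EuclideanSpace ℝ (Fin d)) (i : Fin d) : |u i| ≤ ‖u‖ := by
  rw [EuclideanSpace.norm_eq, ← Real.sqrt_sq_eq_abs]
  refine Real.sqrt_le_sqrt (Finset.single_le_sum (f := fun j => ‖u j‖ ^ 2) (fun j _ => by positivity)
    (Finset.mem_univ i) |>.trans_eq' ?_)
  simp [Real.norm_eq_abs]

/-- **The `Q2`-shaped continuum limit.**  For real Schwartz `w₁, w₂` supported in opposite time slabs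
`{-y_{i₀} ≥ t₀}`, `{y_{i₀} ≥ t₀}` (`t₀ > 0`) and a kernel `K` continuous off the origin and bounded off every
ball around it, the normalised double lattice sums `s_k^{2d} Σ_{x,x' ∈ box d L_k} w₁(s_k x) w₂(s_k x') K(s_k x' - s_k x)`
converge to `∫∫ w₁(x) w₂(y) K(y - x) dy dx` as `0 < s_k → 0`, `s_k L_k → ∞`.  (The separated supports keep
`y - x` at distance `≥ 2t₀` from the singularity, so the integrand is continuous with product Schwartz decay;
then `tendsto_latticeRiemannSum₂` and Fubini.) -/
theorem tendsto_latticeDoubleSum_schwartzKernel {d : ℕ} (i₀ : Fin d)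
    (w₁ w₂ : SchwartzMap (EuclideanSpace ℝ (Fin d)) ℝ) (K : EuclideanSpace ℝ (Fin d) → ℝ) (t₀ : ℝ)
    (ht₀ : 0 < t₀) (h₁ : tsupport (w₁ : EuclideanSpace ℝ (Fin d) → ℝ) ⊆ {y | t₀ ≤ -(y i₀)})
    (h₂ : tsupport (w₂ : EuclideanSpace ℝ (Fin d) → ℝ) ⊆ {y | t₀ ≤ y i₀})
    (hKc : ContinuousOn K {z | z ≠ 0}) (hKb : ∀ η : ℝ, 0 < η → ∃ C : ℝ, ∀ z, η ≤ ‖z‖ → |K z| ≤ C)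
    (s : ℕ → ℝ) (hs : ∀ k, 0 < s k) (hs0 : Tendsto s atTop (𝓝 0))
    (L : ℕ → ℕ) (hL : Tendsto (fun k => s k * L k) atTop atTop) :
    Tendsto (fun k => (s k ^ d) ^ 2 * ∑ x ∈ box d (L k), ∑ x' ∈ box d (L k),
        w₁ (s k • siteToE x) * w₂ (s k • siteToE x') * K (s k • siteToE x' - s k • siteToE x)) atTop
      (𝓝 (∫ x, ∫ y, w₁ x * w₂ y * K (y - x))) := by
  -- separation of the supports
  have hsep : ∀ u v : EuclideanSpace ℝ (Fin d), w₁ u ≠ 0 → w₂ v ≠ 0 → 2 * t₀ ≤ ‖v - u‖ := by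
    intro u v hu hv
    have hu' := h₁ (subset_tsupport _ hu)
    have hv' := h₂ (subset_tsupport _ hv)
    simp only [Set.mem_setOf_eq] at hu' hv'
    have h := abs_apply_le_norm'' (v - u) i₀
    rw [PiLp.sub_apply] at h
    have := le_abs_self (v i₀ - u i₀)
    linarith
  obtain ⟨CK, hCK⟩ := hKb (2 * t₀) (by positivity)
  -- the integrand, its continuity and its decay
  obtain ⟨C₁, hC₁0, hC₁⟩ := schwartz_decay' w₁ (d + 1)
  obtain ⟨C₂, hC₂0, hC₂⟩ := schwartz_decay' w₂ (d + 1)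
  have hdom : ∀ u v : EuclideanSpace ℝ (Fin d), |w₁ u * w₂ v * K (v - u)| ≤
      C₁ * C₂ * max CK 0 * ((1 + ‖u‖) ^ (d + 1))⁻¹ * ((1 + ‖v‖) ^ (d + 1))⁻¹ := by
    intro u v
    by_cases hu : w₁ u = 0
    · rw [hu, zero_mul, zero_mul, abs_zero]; positivity
    by_cases hv : w₂ v = 0
    · rw [hv, mul_zero, zero_mul, abs_zero]; positivity
    have hK : |K (v - u)| ≤ max CK 0 := (hCK _ (hsep u v hu hv)).trans (le_max_left _ _)
    rw [abs_mul, abs_mul]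
    calc |w₁ u| * |w₂ v| * |K (v - u)|
        ≤ (C₁ * ((1 + ‖u‖) ^ (d + 1))⁻¹) * (C₂ * ((1 + ‖v‖) ^ (d + 1))⁻¹) * max CK 0 :=
          mul_le_mul (mul_le_mul (hC₁ u) (hC₂ v) (abs_nonneg _) (mul_nonneg hC₁0 (by positivity))) hK
            (abs_nonneg _) (mul_nonneg (mul_nonneg hC₁0 (by positivity)) (mul_nonneg hC₂0 (by positivity)))
      _ = C₁ * C₂ * max CK 0 * ((1 + ‖u‖) ^ (d + 1))⁻¹ * ((1 + ‖v‖) ^ (d + 1))⁻¹ := by ring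
  have hcont : Continuous fun z : EuclideanSpace ℝ (Fin d) × EuclideanSpace ℝ (Fin d) =>
      w₁ z.1 * w₂ z.2 * K (z.2 - z.1) := by
    refine continuous_iff_continuousAt.2 fun q => ?_
    by_cases hq1 : q.1 ∈ tsupport (w₁ : EuclideanSpace ℝ (Fin d) → ℝ)
    · by_cases hq2 : q.2 ∈ tsupport (w₂ : EuclideanSpace ℝ (Fin d) → ℝ)
      · -- both in the supports: `q.2 - q.1 ≠ 0`, `K` is continuous there
        have hne : q.2 - q.1 ≠ 0 := by
          intro h0
          have hu' := h₁ hq1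
          have hv' := h₂ hq2
          simp only [Set.mem_setOf_eq] at hu' hv'
          have : (q.2 - q.1) i₀ = 0 := by rw [h0]; rfl
          rw [PiLp.sub_apply] at this
          linarith
        have hK : ContinuousAt K (q.2 - q.1) := hKc.continuousAt (isOpen_ne.mem_nhds hne)
        have hsub : ContinuousAt (fun z : EuclideanSpace ℝ (Fin d) × EuclideanSpace ℝ (Fin d) => z.2 - z.1) q :=
          (continuous_snd.sub continuous_fst).continuousAt
        have h3 : ContinuousAt (fun z : EuclideanSpace ℝ (Fin d) × EuclideanSpace ℝ (Fin d) => K (z.2 - z.1)) q :=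
          ContinuousAt.comp (f := fun z : EuclideanSpace ℝ (Fin d) × EuclideanSpace ℝ (Fin d) => z.2 - z.1)
            (x := q) hK hsub
        have h12 : ContinuousAt (fun z : EuclideanSpace ℝ (Fin d) × EuclideanSpace ℝ (Fin d) => w₁ z.1 * w₂ z.2) q :=
          ((w₁.continuous.comp continuous_fst).mul (w₂.continuous.comp continuous_snd)).continuousAt
        exact h12.mul h3
      · -- `w₂` vanishes near `q.2`
        refine (continuousAt_const (y := (0 : ℝ))).congr ?_
        have ho : IsOpen {z : EuclideanSpace ℝ (Fin d) × EuclideanSpace ℝ (Fin d) |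
            z.2 ∈ (tsupport (w₂ : EuclideanSpace ℝ (Fin d) → ℝ))ᶜ} :=
          (isClosed_tsupport _).isOpen_compl.preimage continuous_snd
        filter_upwards [ho.mem_nhds (show q ∈ _ from hq2)] with z hz
        rw [image_eq_zero_of_notMem_tsupport hz, mul_zero, zero_mul]
    · -- `w₁` vanishes near `q.1`
      refine (continuousAt_const (y := (0 : ℝ))).congr ?_
      have ho : IsOpen {z : EuclideanSpace ℝ (Fin d) × EuclideanSpace ℝ (Fin d) |
          z.1 ∈ (tsupport (w₁ : EuclideanSpace ℝ (Fin d) → ℝ))ᶜ} :=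
        (isClosed_tsupport _).isOpen_compl.preimage continuous_fst
      filter_upwards [ho.mem_nhds (show q ∈ _ from hq1)] with z hz
      rw [image_eq_zero_of_notMem_tsupport hz, zero_mul, zero_mul]
  -- the double Riemann sums converge to the product integral
  have hlim := tendsto_latticeRiemannSum₂ (fun u v => w₁ u * w₂ v * K (v - u)) hcont
    (Nat.lt_succ_self d) hdom s hs hs0 L hL
  -- Fubini
  have hint : Integrable (fun z : EuclideanSpace ℝ (Fin d) × EuclideanSpace ℝ (Fin d) =>
      w₁ z.1 * w₂ z.2 * K (z.2 - z.1)) (volume.prod volume) := by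
    have hfr : (Module.finrank ℝ (EuclideanSpace ℝ (Fin d)) : ℝ) < ((d + 1 : ℕ) : ℝ) := by
      rw [finrank_euclideanSpace_fin]; exact_mod_cast Nat.lt_succ_self d
    have h1 := integrable_one_add_norm (E := EuclideanSpace ℝ (Fin d)) (μ := volume) hfr
    have hg := (h1.mul_prod h1).const_mul (C₁ * C₂ * max CK 0)
    refine hg.mono' (hcont.aestronglyMeasurable) (Filter.Eventually.of_forall fun z => ?_)
    rw [Real.norm_eq_abs]
    refine (hdom z.1 z.2).trans (le_of_eq ?_)
    rw [Real.rpow_neg (by positivity), Real.rpow_natCast, Real.rpow_neg (by positivity), Real.rpow_natCast]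
    ring
  have hFub : ∫ z : EuclideanSpace ℝ (Fin d) × EuclideanSpace ℝ (Fin d), w₁ z.1 * w₂ z.2 * K (z.2 - z.1) =
      ∫ x, ∫ y, w₁ x * w₂ y * K (y - x) := by
    rw [Measure.volume_eq_prod, integral_prod _ hint]
  rw [← hFub]
  exact hlim

end Summit.QuantumFields.YangMills.Cruxes.UniversalDetectorLimitExtraction
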